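import Mathlib.Topology.MetricSpace.ProperSpace.Lemmas
import Literature.Probability.Percolation.FlipFairKernel
import Literature.Probability.Percolation.QuadCrossingContinuityReduction

/-!
# The `x`-sections of the pivotal predicate are Borel

Route `Summits/CriticalPhenomena/CardyFormulaZ2/Theses/CardyMeckeFlip`, crux `MeckeRigidity`
(item stmt-CriticalPhenomena-14826), line `registered`, stub `stub_crossingUniqueness` (helper).

For a fixed configuration `S ∈ ℋ_D` and a fixed quad `Q`, the set `{x | S.IsPivotalAt x Q}` of the
points at which flipping toggles `Q` (the pivotal predicate of `FlipFairKernel.lean`, i.e. the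
characterised parameter `Piv` of the crux) is a Borel subset of `ℂ`:

* the OPEN-pivotal clause cuts out a closed set — for `Q ∈ S` it is the intersection of the
  (compact) carriers `[Q']` of the crossed sub-quads `Q'` of `Q` with landing sides in those of `Q`,
  because "no ball around `x` avoids `[Q']`" says exactly `x ∈ closure [Q'] = [Q']`
  (`isClosed_setOf_openPivotal`);
* the CLOSED-pivotal clause cuts out a `G_δ` — at a fixed radius `ε` the set of centres `x` whose
  `ε`-ball receives the landing sides `∂₂Q₁`, `∂₀Q₂` of two crossed sub-quads is open (a compact
  side inside an open ball stays inside after a small displacement of the centre,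
  `isOpen_setOf_subset_ball`, `isOpen_setOf_closedPivotal_lt`), and the clause is monotone in `ε`,
  so `∀ ε > 0` is the countable intersection over `ε = 1/(k+1)`
  (`measurableSet_setOf_closedPivotal`).

Why it matters for the crux: in the flip axiom (F) the inner integrands
`x ↦ φ x * g ({i | Qᵢ ∈ S} Δ {i | Piv S x Qᵢ})` are then Borel measurable in `x` for every fixed
`S`, so the inner Bochner integrals of (F) are honest integrals (no junk values) and the flip
calculus of the uniqueness stub may manipulate them (`measurableSet_isPivotalAt`, registered form
`measurableSet_setOf_isPivotalAt`).
-/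

noncomputable section

open MeasureTheory Set Metric
open Literature.Probability.Percolation Literature.Probability.Percolation.QuadCrossing

namespace Summit.CriticalPhenomena.CardyFormulaZ2.Theorems.CardyMeckeFlip

variable {D : Set ℂ}

/-- For a closed set `K` of the plane and a radius `ε`, the set of centres `x` whose open `ε`-ball
contains `K` is open: `K ⊆ ball x r` for some `r < ε` (the plane is proper), and then
`K ⊆ ball x' ε` whenever `dist x' x < ε - r`. [folklore] -/
theorem isOpen_setOf_subset_ball {K : Set ℂ} (hK : IsClosed K) (ε : ℝ) :
    IsOpen {x : ℂ | K ⊆ ball x ε} := by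
  refine Metric.isOpen_iff.mpr fun x (hx : K ⊆ ball x ε) => ?_
  obtain ⟨r, hr, hKr⟩ := exists_lt_subset_ball hK hx
  refine ⟨ε - r, sub_pos.mpr hr, fun x' hx' y hy => mem_ball.mpr ?_⟩
  calc dist y x' ≤ dist y x + dist x x' := dist_triangle y x x'
    _ < r + (ε - r) := add_lt_add (mem_ball.mp (hKr hy)) (mem_ball'.mp hx')
    _ = ε := by ring

/-- **The open-pivotal clause cuts out a closed set.**  For `Q ∈ S` it is the intersection of the
carriers `[Q']` of the crossed sub-quads `Q'` of `Q` with landing sides in those of `Q` — no ball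
around `x` avoids the compact set `[Q'] ⊆ [Q]` iff `x ∈ [Q']` — and for `Q ∉ S` it is empty.
[folklore] -/
theorem isClosed_setOf_openPivotal (S : QuadConfig D) (Q : Quad D) :
    IsClosed {x : ℂ | Q ∈ S ∧ ∀ ε : ℝ, 0 < ε → ∀ Q' : Quad D,
      Q'.carrier ⊆ Q.carrier \ ball x ε → Q'.side 0 ⊆ Q.side 0 → Q'.side 2 ⊆ Q.side 2 →
        Q' ∉ S} := by
  have key : ∀ x : ℂ, (∀ ε : ℝ, 0 < ε → ∀ Q' : Quad D, Q'.carrier ⊆ Q.carrier \ ball x ε →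
      Q'.side 0 ⊆ Q.side 0 → Q'.side 2 ⊆ Q.side 2 → Q' ∉ S) ↔
        ∀ Q' : Quad D, Q' ∈ S → Q'.side 0 ⊆ Q.side 0 → Q'.side 2 ⊆ Q.side 2 →
          Q'.carrier ⊆ Q.carrier → x ∈ Q'.carrier := by
    intro x
    constructor
    · intro h Q' hQ' h0 h2 hcar
      by_contra hx
      obtain ⟨ε, hε, hball⟩ :=
        Metric.isOpen_iff.mp Q'.isCompact_carrier.isClosed.isOpen_compl x hx
      exact h ε hε Q' (fun y hy => ⟨hcar hy, fun hyb => hball hyb hy⟩) h0 h2 hQ'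
    · intro h ε hε Q' hcar h0 h2 hQ'
      exact (hcar (h Q' hQ' h0 h2 fun y hy => (hcar hy).1)).2 (mem_ball_self hε)
  have hC : {x : ℂ | Q ∈ S ∧ ∀ ε : ℝ, 0 < ε → ∀ Q' : Quad D,
      Q'.carrier ⊆ Q.carrier \ ball x ε → Q'.side 0 ⊆ Q.side 0 → Q'.side 2 ⊆ Q.side 2 →
        Q' ∉ S} =
      {_x : ℂ | Q ∈ S} ∩ ⋂ (Q' : Quad D) (_ : Q' ∈ S) (_ : Q'.side 0 ⊆ Q.side 0)
        (_ : Q'.side 2 ⊆ Q.side 2) (_ : Q'.carrier ⊆ Q.carrier), Q'.carrier := by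
    ext x
    simp only [mem_setOf_eq, mem_inter_iff, mem_iInter]
    exact and_congr_right fun _ => key x
  rw [hC]
  exact isClosed_const.inter (isClosed_iInter fun Q' => isClosed_iInter fun _ =>
    isClosed_iInter fun _ => isClosed_iInter fun _ => isClosed_iInter fun _ =>
      Q'.isCompact_carrier.isClosed)

/-- **The closed-pivotal clause at a fixed radius cuts out an open set**: if the `ε`-ball around
`x` receives the landing sides `∂₂Q₁` and `∂₀Q₂` of two crossed sub-quads of `Q`, then so does the
`ε`-ball around every `x'` close to `x` (the sides are compact), with the same two sub-quads.
[folklore] -/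
theorem isOpen_setOf_closedPivotal_lt (S : QuadConfig D) (Q : Quad D) (ε : ℝ) :
    IsOpen {x : ℂ | ∃ Q₁ Q₂ : Quad D, Q₁ ∈ S ∧ Q₂ ∈ S ∧ Q₁.carrier ⊆ Q.carrier ∧
      Q₂.carrier ⊆ Q.carrier ∧ Q₁.side 0 ⊆ Q.side 0 ∧ Q₁.side 2 ⊆ ball x ε ∧
        Q₂.side 0 ⊆ ball x ε ∧ Q₂.side 2 ⊆ Q.side 2} := by
  refine isOpen_iff_forall_mem_open.mpr fun x hx => ?_
  obtain ⟨Q₁, Q₂, h₁, h₂, h₁c, h₂c, h₁0, h₁2, h₂0, h₂2⟩ := hx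
  refine ⟨{x' : ℂ | Q₁.side 2 ⊆ ball x' ε} ∩ {x' : ℂ | Q₂.side 0 ⊆ ball x' ε}, ?_, ?_, h₁2, h₂0⟩
  · rintro x' ⟨h₁2', h₂0'⟩
    exact ⟨Q₁, Q₂, h₁, h₂, h₁c, h₂c, h₁0, h₁2', h₂0', h₂2⟩
  · exact (isOpen_setOf_subset_ball (Q₁.isCompact_side 2).isClosed ε).inter
      (isOpen_setOf_subset_ball (Q₂.isCompact_side 0).isClosed ε)

/-- **The closed-pivotal clause cuts out a Borel (`G_δ`) set**: the clause is monotone in the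
radius, so `∀ ε > 0` may be replaced by the countable family of radii `1/(k+1)`, `k : ℕ`, at each
of which the clause cuts out an open set. [folklore] -/
theorem measurableSet_setOf_closedPivotal (S : QuadConfig D) (Q : Quad D) :
    MeasurableSet {x : ℂ | Q ∉ S ∧ ∀ ε : ℝ, 0 < ε → ∃ Q₁ Q₂ : Quad D, Q₁ ∈ S ∧ Q₂ ∈ S ∧
      Q₁.carrier ⊆ Q.carrier ∧ Q₂.carrier ⊆ Q.carrier ∧ Q₁.side 0 ⊆ Q.side 0 ∧
        Q₁.side 2 ⊆ ball x ε ∧ Q₂.side 0 ⊆ ball x ε ∧ Q₂.side 2 ⊆ Q.side 2} := by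
  have hmono : ∀ {ε ε' : ℝ} {x : ℂ}, ε ≤ ε' →
      (∃ Q₁ Q₂ : Quad D, Q₁ ∈ S ∧ Q₂ ∈ S ∧ Q₁.carrier ⊆ Q.carrier ∧
        Q₂.carrier ⊆ Q.carrier ∧ Q₁.side 0 ⊆ Q.side 0 ∧ Q₁.side 2 ⊆ ball x ε ∧
          Q₂.side 0 ⊆ ball x ε ∧ Q₂.side 2 ⊆ Q.side 2) →
      ∃ Q₁ Q₂ : Quad D, Q₁ ∈ S ∧ Q₂ ∈ S ∧ Q₁.carrier ⊆ Q.carrier ∧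
        Q₂.carrier ⊆ Q.carrier ∧ Q₁.side 0 ⊆ Q.side 0 ∧ Q₁.side 2 ⊆ ball x ε' ∧
          Q₂.side 0 ⊆ ball x ε' ∧ Q₂.side 2 ⊆ Q.side 2 := by
    rintro ε ε' x h ⟨Q₁, Q₂, h₁, h₂, h₁c, h₂c, h₁0, h₁2, h₂0, h₂2⟩
    exact ⟨Q₁, Q₂, h₁, h₂, h₁c, h₂c, h₁0, h₁2.trans (ball_subset_ball h),
      h₂0.trans (ball_subset_ball h), h₂2⟩
  have hC : {x : ℂ | Q ∉ S ∧ ∀ ε : ℝ, 0 < ε → ∃ Q₁ Q₂ : Quad D, Q₁ ∈ S ∧ Q₂ ∈ S ∧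
      Q₁.carrier ⊆ Q.carrier ∧ Q₂.carrier ⊆ Q.carrier ∧ Q₁.side 0 ⊆ Q.side 0 ∧
        Q₁.side 2 ⊆ ball x ε ∧ Q₂.side 0 ⊆ ball x ε ∧ Q₂.side 2 ⊆ Q.side 2} =
      {_x : ℂ | Q ∉ S} ∩ ⋂ k : ℕ, {x : ℂ | ∃ Q₁ Q₂ : Quad D, Q₁ ∈ S ∧ Q₂ ∈ S ∧
        Q₁.carrier ⊆ Q.carrier ∧ Q₂.carrier ⊆ Q.carrier ∧ Q₁.side 0 ⊆ Q.side 0 ∧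
          Q₁.side 2 ⊆ ball x (1 / ((k : ℝ) + 1)) ∧ Q₂.side 0 ⊆ ball x (1 / ((k : ℝ) + 1)) ∧
            Q₂.side 2 ⊆ Q.side 2} := by
    ext x
    simp only [mem_setOf_eq, mem_inter_iff, mem_iInter]
    refine and_congr_right fun _ => ⟨fun h k => h (1 / ((k : ℝ) + 1)) Nat.one_div_pos_of_nat,
      fun h ε hε => ?_⟩
    obtain ⟨k, hk⟩ := exists_nat_one_div_lt hε
    exact hmono hk.le (h k)
  rw [hC]
  exact (MeasurableSet.const _).inter
    (MeasurableSet.iInter fun k => (isOpen_setOf_closedPivotal_lt S Q _).measurableSet)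

/-- **The `x`-sections of the pivotal predicate are Borel**: for fixed `S ∈ ℋ_D` and `Q ∈ 𝒬_D` the
set `{x | S.IsPivotalAt x Q}` is a measurable subset of `ℂ` (a closed open-pivotal part and a `G_δ`
closed-pivotal part). [folklore] -/
theorem measurableSet_isPivotalAt (S : QuadConfig D) (Q : Quad D) :
    MeasurableSet {x : ℂ | S.IsPivotalAt x Q} :=
  (isClosed_setOf_openPivotal S Q).measurableSet.union (measurableSet_setOf_closedPivotal S Q)

/-- **Borel `x`-sections of the pivotal predicate, registered form** (sub-goal
`measurableSet_setOf_isPivotalAt` of item stmt-CriticalPhenomena-14826): the inner integrands of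
the flip axiom (F) are measurable in `x`. [folklore] -/
theorem measurableSet_setOf_isPivotalAt : ∀ (D : Set ℂ) (S : QuadConfig D) (Q : Quad D), MeasurableSet {x : ℂ | S.IsPivotalAt x Q} := by
  intro D S Q
  exact measurableSet_isPivotalAt S Q

end Summit.CriticalPhenomena.CardyFormulaZ2.Theorems.CardyMeckeFlip

end
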